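import Literature.Topology.FourManifolds.NonSeparatingSpheres
import Literature.Topology.FourManifolds.InverseFunctionTheorem
import HarnessLib

/-!
# Budney–Gabai Thm. 3.13: near its crossing with `S¹ × {p₀}` the sphere is a graph over `Sⁿ`

Fact seat of `Literature.Topology.FourManifolds.BudneyGabai2019_thm_3_13` (R. Budney, D. Gabai,
*Knotted 3-balls in `S⁴`*, arXiv:1912.09029, Thm. 3.13).  Third sentence of the printed proof
(p. 22): *"If we drill a neighbourhood of `S¹ × {*}` out of `S¹ × Sⁿ` we have constructed
`S¹ × Bⁿ`, and our non-separating sphere is converted to a reducing ball."*  For this the sphere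
`K = e(Sⁿ)` must meet a tube `S¹ × D` about the standardised dual circle `S¹ × {p₀}` in a single
`n`-disc.  `NonSeparatingSpheresTransversePoint.lean` shows that at the unique crossing point
`e x₀` the differential of `pr₂ ∘ e : Sⁿ → Sⁿ` is injective; here we draw the local consequence
(inverse function theorem + compactness of `Sⁿ`):

* `BudneyGabai2019_thm_3_13.exists_localInverse_snd_comp` — there are `r > 0` and a `C^∞` local
  inverse `σ` of `pr₂ ∘ e` on the ball `B(p₀, r) ⊆ Sⁿ` with `σ p₀ = x₀` such that
  `(pr₂ ∘ e)⁻¹ (B(p₀, r)) = σ (B(p₀, r))`; consequently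
* `BudneyGabai2019_thm_3_13.range_inter_eq_graph` — `K ∩ (S¹ × B(p₀, r))` is the graph
  `{(g p, p) | p ∈ B(p₀, r)}` of the `C^∞` map `g = pr₁ ∘ e ∘ σ : B(p₀, r) → S¹`.

Everything here is proved; no definition and no named fact is introduced.

## References

* R. Budney, D. Gabai, *Knotted 3-balls in `S⁴`*, arXiv:1912.09029 (v2), §3, proof of Thm. 3.13
  (p. 22). [BudneyGabai2019]
* J. M. Lee, *Introduction to Smooth Manifolds*, 2nd ed., GTM 218 (2013), Thm. 4.5 (inverse
  function theorem for manifolds). [LeeSmoothManifolds2013]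
-/

noncomputable section

open scoped Manifold ContDiff Topology
open Set Function Metric Module Filter

namespace Literature.Topology.FourManifolds

namespace BudneyGabai2019_thm_3_13

variable {n : ℕ}

/-- **Local inverse of `pr₂ ∘ e` at a transversal crossing.**  Let `e : Sⁿ → S¹ × Sⁿ` be a smooth
embedding, `x₀` the only point of `Sⁿ` with `(e x₀)₂ = p₀`, and suppose `d(pr₂ ∘ e)_{x₀}` is
injective.  Then there are `r > 0` and a map `σ : Sⁿ → Sⁿ`, `C^∞` on the ball `B(p₀, r)`, with
`σ p₀ = x₀`, `(e (σ p))₂ = p` for `p ∈ B(p₀, r)`, and such that every `x` with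
`(e x)₂ ∈ B(p₀, r)` equals `σ (e x)₂` (inverse function theorem for manifolds, and compactness of
`Sⁿ`: away from a neighbourhood of `x₀` the map `pr₂ ∘ e` stays at positive distance from `p₀`).
[cite: LeeSmoothManifolds2013, Thm. 4.5] -/
theorem exists_localInverse_snd_comp
    {e : Metric.sphere (0 : EuclideanSpace ℝ (Fin (n + 1))) 1 →
      Circle × Metric.sphere (0 : EuclideanSpace ℝ (Fin (n + 1))) 1}
    (he : Manifold.IsSmoothEmbedding (𝓡 n) ((𝓡 1).prod (𝓡 n)) ∞ e)
    {x₀ p₀ : Metric.sphere (0 : EuclideanSpace ℝ (Fin (n + 1))) 1} (hx₀ : (e x₀).2 = p₀)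
    (hcross : ∀ x, (e x).2 = p₀ → x = x₀)
    (hinj : Injective (mfderiv (𝓡 n) (𝓡 n)
      (fun x ↦ (e x).2 : Metric.sphere (0 : EuclideanSpace ℝ (Fin (n + 1))) 1 →
        Metric.sphere (0 : EuclideanSpace ℝ (Fin (n + 1))) 1) x₀)) :
    ∃ (r : ℝ) (σ : Metric.sphere (0 : EuclideanSpace ℝ (Fin (n + 1))) 1 →
        Metric.sphere (0 : EuclideanSpace ℝ (Fin (n + 1))) 1),
      0 < r ∧ ContMDiffOn (𝓡 n) (𝓡 n) ∞ σ (ball p₀ r) ∧ σ p₀ = x₀ ∧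
      (∀ p ∈ ball p₀ r, (e (σ p)).2 = p) ∧
      ∀ x, (e x).2 ∈ ball p₀ r → x = σ (e x).2 := by
  set F : Metric.sphere (0 : EuclideanSpace ℝ (Fin (n + 1))) 1 →
      Metric.sphere (0 : EuclideanSpace ℝ (Fin (n + 1))) 1 := fun x ↦ (e x).2 with hF
  have hFs : ContMDiff (𝓡 n) (𝓡 n) ∞ F := contMDiff_snd.comp he.contMDiff
  have hFc : Continuous F := hFs.continuous
  -- the differential at `x₀` is a linear isomorphism (injective endomorphism of `ℝⁿ`)
  set A : EuclideanSpace ℝ (Fin n) →L[ℝ] EuclideanSpace ℝ (Fin n) := mfderiv (𝓡 n) (𝓡 n) F x₀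
    with hA
  have hinj' : Injective A.toLinearMap := hinj
  set L : EuclideanSpace ℝ (Fin n) ≃L[ℝ] EuclideanSpace ℝ (Fin n) :=
    (LinearMap.linearEquivOfInjective A.toLinearMap hinj' rfl).toContinuousLinearEquiv with hLdef
  have hL : mfderiv (𝓡 n) (𝓡 n) F x₀ =
      (L : EuclideanSpace ℝ (Fin n) →L[ℝ] EuclideanSpace ℝ (Fin n)) := by
    ext1 v
    show A v = L v
    simp [hLdef]
  have hloc : IsLocalDiffeomorphAt (𝓡 n) (𝓡 n) ∞ F x₀ :=
    isLocalDiffeomorphAt_of_mfderiv isOpen_univ (mem_univ _) hFs.contMDiffOn (by simp) L hL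
  set Φ := hloc.localInverse with hΦ
  -- `Φ.source ∋ p₀` (open), `Φ.target ∋ x₀` (open)
  have hp₀S : p₀ ∈ Φ.source := by
    rw [← hx₀]
    exact hloc.localInverse_mem_source
  have hx₀T : x₀ ∈ Φ.target := hloc.localInverse_mem_target
  -- away from `Φ.target`, `F` stays away from `p₀`
  have hTc : IsCompact (Φ.targetᶜ) := Φ.open_target.isClosed_compl.isCompact
  have hIm : IsClosed (F '' Φ.targetᶜ) := (hTc.image hFc).isClosed
  have hp₀Im : p₀ ∈ (F '' Φ.targetᶜ)ᶜ := by
    rintro ⟨x, hxT, hxp⟩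
    exact hxT (hcross x hxp ▸ hx₀T)
  obtain ⟨r₁, hr₁, hr₁sub⟩ := Metric.isOpen_iff.1 hIm.isOpen_compl p₀ hp₀Im
  obtain ⟨r₂, hr₂, hr₂sub⟩ := Metric.isOpen_iff.1 Φ.open_source p₀ hp₀S
  refine ⟨min r₁ r₂, Φ, lt_min hr₁ hr₂, ?_, ?_, ?_, ?_⟩
  · exact hloc.localInverse_contMDiffOn.mono
      ((ball_subset_ball (min_le_right _ _)).trans hr₂sub)
  · rw [← hx₀]
    exact hloc.localInverse_left_inv hx₀T
  · intro p hp
    exact hloc.localInverse_right_inv (hr₂sub (ball_subset_ball (min_le_right _ _) hp))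
  · intro x hx
    have hxT : x ∈ Φ.target := by
      by_contra hxT
      exact hr₁sub (ball_subset_ball (min_le_left _ _) hx) ⟨x, hxT, rfl⟩
    exact (hloc.localInverse_left_inv hxT).symm

/-- **Near the crossing the sphere is a graph over `Sⁿ`.**  With `σ` a local inverse of
`pr₂ ∘ e` on `B(p₀, r)` as in `exists_localInverse_snd_comp`, the part of the sphere `e(Sⁿ)`
over the ball `B(p₀, r)` is the graph of `g := pr₁ ∘ e ∘ σ`:
`e(Sⁿ) ∩ (S¹ × B(p₀, r)) = {(g p, p) | p ∈ B(p₀, r)}`. [cite: BudneyGabai2019, proof of Thm. 3.13] -/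
theorem range_inter_eq_graph
    {e : Metric.sphere (0 : EuclideanSpace ℝ (Fin (n + 1))) 1 →
      Circle × Metric.sphere (0 : EuclideanSpace ℝ (Fin (n + 1))) 1}
    {p₀ : Metric.sphere (0 : EuclideanSpace ℝ (Fin (n + 1))) 1} {r : ℝ}
    {σ : Metric.sphere (0 : EuclideanSpace ℝ (Fin (n + 1))) 1 →
      Metric.sphere (0 : EuclideanSpace ℝ (Fin (n + 1))) 1}
    (hright : ∀ p ∈ ball p₀ r, (e (σ p)).2 = p) (hleft : ∀ x, (e x).2 ∈ ball p₀ r → x = σ (e x).2) :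
    range e ∩ {q | q.2 ∈ ball p₀ r} = (fun p ↦ ((e (σ p)).1, p)) '' ball p₀ r := by
  ext q
  constructor
  · rintro ⟨⟨x, rfl⟩, hq⟩
    refine ⟨(e x).2, hq, ?_⟩
    have hx : x = σ (e x).2 := hleft x hq
    have h2 : (e (σ (e x).2)).2 = (e x).2 := hright _ hq
    calc ((e (σ (e x).2)).1, (e x).2) = ((e (σ (e x).2)).1, (e (σ (e x).2)).2) := by rw [h2]
      _ = e (σ (e x).2) := rfl
      _ = e x := by rw [← hx]
  · rintro ⟨p, hp, rfl⟩
    refine ⟨⟨σ p, Prod.ext rfl (hright p hp)⟩, ?_⟩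
    simpa using hp

end BudneyGabai2019_thm_3_13

end Literature.Topology.FourManifolds

end
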